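import Mathlib
import Summits.Ventures.PercRepro2.LocRows
import Summits.Ventures.PercRepro2.SwRow
import Summits.Ventures.PercRepro2.SwOut
import Summits.Ventures.PercRepro2.SwAllRow
import Summits.Ventures.PercRepro2.SwOutAll
import Summits.Ventures.PercRepro2.SwOutArmFlip
import Summits.Ventures.PercRepro2.SwOutArmThm
import Summits.Ventures.PercRepro2.SwOutCoreDefs

/-!
# The core cube: the hull formula (blind cell PercRepro2, night-4 g13, 2026-08-26;
proofs/NIGHT4-G12.md §3 (L1), proofs/NIGHT4-G13.md §2)

For a core base (`CoreBase`) and a cube point `ω`, the red cluster of `h` of the realisation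
`coreReal ζ ω` is exactly `redSet ω`: `h`, the red h-arms and — when some red h-arm is adjacent to
`u` — `u` with the red pure arms (`cluster_coreReal`).  Proof: `redSet ω` is closed under red
adjacency (`redSet_closed`: a red edge leaving a red arm ends at `h`, at `u` or outside the hull,
where the base colouring makes it blue), and every vertex of it is red-connected to `h` inside its
arm (`harm_conn` / `pure_conn` of the base, transported by `insideConfig_le_coreReal`).  The
envelope `redAll ω = {h, u} ∪ red arms` is red-closed as well (`redAll_closed`), which is what the
monotonicity of `C_R(l)` needs (`SwOutCoreDual`).
-/

namespace Summit.Ventures.PercRepro2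

namespace LocRows

open Hull

variable {V : Type*} {E : Type*}

open scoped Classical

variable {ends : E → Sym2 V}

section Hull

variable {ι : Type*} {A : ι → Set V} {pure : ι → Prop} {ζ : Config E} {h u : V} {H : Set V}
  (hb : CoreBase ends ζ h u H A pure)
include hb

omit hb in
/-- Membership in `redSet`. -/
lemma mem_redSet_iff {ω : Config ι} {x : V} :
    x ∈ redSet ends A h u pure ω ↔
      x = h ∨ (∃ i, ω i = true ∧ ¬ pure i ∧ x ∈ A i) ∨
        (uRed ends A u pure ω ∧ (x = u ∨ ∃ i, ω i = true ∧ pure i ∧ x ∈ A i)) := by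
  simp only [redSet, Set.mem_union, Set.mem_singleton_iff, Set.mem_setOf_eq, or_assoc]

omit hb in
/-- Membership in `redAll`. -/
lemma mem_redAll_iff {ω : Config ι} {x : V} :
    x ∈ redAll A h u ω ↔ x = h ∨ x = u ∨ ∃ i, ω i = true ∧ x ∈ A i := by
  simp only [redAll, armsTrueC, Set.mem_union, Set.mem_singleton_iff, Set.mem_setOf_eq, or_assoc]

omit hb in
/-- `redSet ω ⊆ redAll ω`. -/
lemma redSet_subset_redAll (ω : Config ι) : redSet ends A h u pure ω ⊆ redAll A h u ω := by
  intro x hx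
  rw [mem_redSet_iff] at hx
  rw [mem_redAll_iff]
  rcases hx with rfl | ⟨i, hi, _, hx⟩ | ⟨_, rfl | ⟨i, hi, _, hx⟩⟩
  · exact Or.inl rfl
  · exact Or.inr (Or.inr ⟨i, hi, hx⟩)
  · exact Or.inr (Or.inl rfl)
  · exact Or.inr (Or.inr ⟨i, hi, hx⟩)

/-- `u ∈ H`. -/
lemma CoreBase.u_mem : u ∈ H := by
  obtain ⟨i, _, e, x, hux, hx⟩ := hb.u_hadj
  by_contra huH
  have h1 := hb.bdry_blue e x u (ends_swap hux) (hb.arm_sub i x hx).1 huH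
  have h2 := hb.u_red e x hux
  rw [h1] at h2; exact absurd h2 (by decide)

/-- `h ∈ H`. -/
lemma CoreBase.h_mem : h ∈ H := by
  obtain ⟨i, hpi, _, x, _, hx⟩ := hb.u_hadj
  by_contra hhH
  -- every edge at `h` is blue: then the inside-red cluster of `h` is `{h}`
  have hcl := hb.harm_conn i hpi x hx
  have key : x ∈ ({h} : Set V) := by
    refine mem_of_conn_of_closed (ends := ends) (ω := insideConfig ends (A i ∪ {h}) ζ) ?_
      rfl hcl
    intro a ha b hab
    obtain ⟨_, e, he, hends⟩ := openGraph_adj.1 hab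
    rw [Set.mem_singleton_iff] at ha
    subst ha
    exfalso
    obtain ⟨hζe, _⟩ := insideConfig_eq_true_iff.1 he
    obtain ⟨j, hb'⟩ := hb.h_edges e b hends
    have := hb.bdry_blue e b a (ends_swap hends) (hb.arm_sub j b hb').1 hhH
    rw [this] at hζe; exact absurd hζe (by decide)
  rw [Set.mem_singleton_iff] at key
  exact (hb.arm_sub i x hx).2.1 key

/-- `redAll ω ⊆ H`. -/
lemma CoreBase.redAll_subset (ω : Config ι) : redAll A h u ω ⊆ H := by
  intro x hx
  rw [mem_redAll_iff] at hx
  rcases hx with rfl | rfl | ⟨i, _, hx⟩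
  · exact hb.h_mem
  · exact hb.u_mem
  · exact (hb.arm_sub i x hx).1

/-- `redSet ω ⊆ H`. -/
lemma CoreBase.redSet_subset (ω : Config ι) : redSet ends A h u pure ω ⊆ H :=
  (redSet_subset_redAll ω).trans (hb.redAll_subset ω)

/-- A red edge of a realisation leaving `A i` (with `A i` red) ends at `h` or at `u`. -/
lemma CoreBase.end_of_red_of_mem_arm {ω : Config ι} {i : ι} (hi : ω i = true) {e : E} {a b : V}
    (hends : ends e = s(a, b)) (ha : a ∈ A i) (he : coreReal ends A ζ ω e = true) :
    b ∈ A i ∨ b = h ∨ b = u := by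
  by_cases hbH : b ∈ H
  · by_cases hbh : b = h
    · exact Or.inr (Or.inl hbh)
    by_cases hbu : b = u
    · exact Or.inr (Or.inr hbu)
    obtain ⟨j, hbj⟩ := hb.arm_cover b hbH hbh hbu
    have hij : i = j := hb.arm_eq_of_edge hends ha hbj
    subst hij
    exact Or.inl hbj
  · exfalso
    have h1 := hb.bdry_blue e a b hends (hb.arm_sub i a ha).1 hbH
    rw [hb.coreReal_apply_of_mem hends ha, if_pos hi, h1] at he
    exact absurd he (by decide)

/-- A red edge of a realisation at `h` enters a red h-arm. -/
lemma CoreBase.red_arm_of_red_at_h {ω : Config ι} {e : E} {b : V} (hends : ends e = s(h, b))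
    (he : coreReal ends A ζ ω e = true) : ∃ j, ω j = true ∧ ¬ pure j ∧ b ∈ A j := by
  obtain ⟨j, hbj⟩ := hb.h_edges e b hends
  refine ⟨j, ?_, fun hp => hb.pure_no_h j hp e b hends hbj, hbj⟩
  rw [hb.coreReal_apply_of_mem (ends_swap hends) hbj, hb.h_red e b hends] at he
  by_contra hj
  rw [if_neg hj] at he
  exact absurd he (by decide)

/-- A red edge of a realisation at `u` enters a red arm. -/
lemma CoreBase.red_arm_of_red_at_u {ω : Config ι} {e : E} {b : V} (hends : ends e = s(u, b))
    (he : coreReal ends A ζ ω e = true) : ∃ j, ω j = true ∧ b ∈ A j := by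
  obtain ⟨j, hbj⟩ := hb.u_edges e b hends
  refine ⟨j, ?_, hbj⟩
  rw [hb.coreReal_apply_of_mem (ends_swap hends) hbj, hb.u_red e b hends] at he
  by_contra hj
  rw [if_neg hj] at he
  exact absurd he (by decide)

/-- **`redAll ω` is closed under red adjacency.** -/
theorem CoreBase.redAll_closed (ω : Config ι) :
    ∀ a ∈ redAll A h u ω, ∀ b, (openGraph ends (coreReal ends A ζ ω)).Adj a b →
      b ∈ redAll A h u ω := by
  intro a ha b hab
  obtain ⟨_, e, he, hends⟩ := openGraph_adj.1 hab
  rw [mem_redAll_iff] at ha ⊢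
  rcases ha with rfl | rfl | ⟨i, hi, ha⟩
  · obtain ⟨j, hj, _, hbj⟩ := hb.red_arm_of_red_at_h hends he
    exact Or.inr (Or.inr ⟨j, hj, hbj⟩)
  · obtain ⟨j, hj, hbj⟩ := hb.red_arm_of_red_at_u hends he
    exact Or.inr (Or.inr ⟨j, hj, hbj⟩)
  · rcases hb.end_of_red_of_mem_arm hi hends ha he with hbi | hbh | hbu
    · exact Or.inr (Or.inr ⟨i, hi, hbi⟩)
    · exact Or.inl hbh
    · exact Or.inr (Or.inl hbu)

/-- **`redSet ω` is closed under red adjacency.** -/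
theorem CoreBase.redSet_closed (ω : Config ι) :
    ∀ a ∈ redSet ends A h u pure ω, ∀ b, (openGraph ends (coreReal ends A ζ ω)).Adj a b →
      b ∈ redSet ends A h u pure ω := by
  intro a ha b hab
  obtain ⟨_, e, he, hends⟩ := openGraph_adj.1 hab
  rw [mem_redSet_iff] at ha ⊢
  rcases ha with rfl | ⟨i, hi, hpi, ha⟩ | ⟨hu, rfl | ⟨i, hi, hpi, ha⟩⟩
  · -- from `h` into a red h-arm
    obtain ⟨j, hj, hpj, hbj⟩ := hb.red_arm_of_red_at_h hends he
    exact Or.inr (Or.inl ⟨j, hj, hpj, hbj⟩)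
  · -- from a red h-arm: inside it, to `h`, or to `u` (which is then red)
    rcases hb.end_of_red_of_mem_arm hi hends ha he with hbi | hbh | hbu
    · exact Or.inr (Or.inl ⟨i, hi, hpi, hbi⟩)
    · exact Or.inl hbh
    · subst hbu
      exact Or.inr (Or.inr ⟨⟨i, hi, hpi, e, a, ends_swap hends, ha⟩, Or.inl rfl⟩)
  · -- from `u` (red) into a red arm
    obtain ⟨j, hj, hbj⟩ := hb.red_arm_of_red_at_u hends he
    by_cases hpj : pure j
    · exact Or.inr (Or.inr ⟨hu, Or.inr ⟨j, hj, hpj, hbj⟩⟩)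
    · exact Or.inr (Or.inl ⟨j, hj, hpj, hbj⟩)
  · -- from a red pure arm (with `u` red): inside it or to `u`
    rcases hb.end_of_red_of_mem_arm hi hends ha he with hbi | hbh | hbu
    · exact Or.inr (Or.inr ⟨hu, Or.inr ⟨i, hi, hpi, hbi⟩⟩)
    · exfalso
      subst hbh
      exact hb.pure_no_h i hpi e a (ends_swap hends) ha
    · exact Or.inr (Or.inr ⟨hu, Or.inl hbu⟩)

/-- Every vertex of a red h-arm lies in the red cluster of `h` of the realisation. -/
lemma CoreBase.mem_cluster_of_harm {ω : Config ι} {i : ι} (hi : ω i = true) (hpi : ¬ pure i)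
    {x : V} (hx : x ∈ A i) : x ∈ cluster ends (coreReal ends A ζ ω) h :=
  cluster_mono (hb.insideConfig_le_coreReal hi (Or.inl rfl)) h (hb.harm_conn i hpi x hx)

/-- When some red h-arm is adjacent to `u`, `u` lies in the red cluster of `h`. -/
lemma CoreBase.u_mem_cluster_of_uRed {ω : Config ι} (hu : uRed ends A u pure ω) :
    u ∈ cluster ends (coreReal ends A ζ ω) h := by
  obtain ⟨i, hi, hpi, e, x, hux, hx⟩ := hu
  have hxT := hb.mem_cluster_of_harm hi hpi hx
  refine mem_cluster_of_edge hxT ?_ (ends_swap hux)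
  rw [hb.coreReal_apply_of_mem (ends_swap hux) hx, if_pos hi]
  exact hb.u_red e x hux

/-- Every vertex of a red pure arm lies in the red cluster of `h` when `u` is red. -/
lemma CoreBase.mem_cluster_of_pure {ω : Config ι} (hu : uRed ends A u pure ω) {i : ι}
    (hi : ω i = true) (hpi : pure i) {x : V} (hx : x ∈ A i) :
    x ∈ cluster ends (coreReal ends A ζ ω) h := by
  have h1 : x ∈ cluster ends (coreReal ends A ζ ω) u :=
    cluster_mono (hb.insideConfig_le_coreReal hi (Or.inr rfl)) u (hb.pure_conn i hpi x hx)
  exact conn_trans (hb.u_mem_cluster_of_uRed hu) h1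

/-- **The hull formula**: the red cluster of `h` of a cube point is `redSet ω`. -/
theorem CoreBase.cluster_coreReal (ω : Config ι) :
    cluster ends (coreReal ends A ζ ω) h = redSet ends A h u pure ω := by
  apply Set.Subset.antisymm
  · intro v hv
    exact mem_of_conn_of_closed (hb.redSet_closed ω) (by rw [mem_redSet_iff]; exact Or.inl rfl) hv
  · intro v hv
    rw [mem_redSet_iff] at hv
    rcases hv with rfl | ⟨i, hi, hpi, hv⟩ | ⟨hu, rfl | ⟨i, hi, hpi, hv⟩⟩
    · exact mem_cluster_self _ _ _
    · exact hb.mem_cluster_of_harm hi hpi hv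
    · exact hb.u_mem_cluster_of_uRed hu
    · exact hb.mem_cluster_of_pure hu hi hpi hv

/-- The red cluster of `h` of a cube point lies in `H`. -/
lemma CoreBase.cluster_coreReal_subset (ω : Config ι) :
    cluster ends (coreReal ends A ζ ω) h ⊆ H := by
  rw [hb.cluster_coreReal]; exact hb.redSet_subset ω

/-- `redSet` grows with the cube point. -/
lemma CoreBase.redSet_mono {ω ω' : Config ι} (hω : ω ≤ ω') :
    redSet ends A h u pure ω ⊆ redSet ends A h u pure ω' := by
  have hle : ∀ i, ω i = true → ω' i = true := by
    intro i hi
    have := hω i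
    rw [hi] at this
    cases h' : ω' i
    · rw [h'] at this; exact absurd this (by simp)
    · rfl
  have huRed : uRed ends A u pure ω → uRed ends A u pure ω' := by
    rintro ⟨i, hi, hpi, e, x, hux, hx⟩
    exact ⟨i, hle i hi, hpi, e, x, hux, hx⟩
  intro x hx
  rw [mem_redSet_iff] at hx ⊢
  rcases hx with rfl | ⟨i, hi, hpi, hx⟩ | ⟨hu, rfl | ⟨i, hi, hpi, hx⟩⟩
  · exact Or.inl rfl
  · exact Or.inr (Or.inl ⟨i, hle i hi, hpi, hx⟩)
  · exact Or.inr (Or.inr ⟨huRed hu, Or.inl rfl⟩)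
  · exact Or.inr (Or.inr ⟨huRed hu, Or.inr ⟨i, hle i hi, hpi, hx⟩⟩)

/-- The red cluster of `h` grows with the cube point. -/
lemma CoreBase.cluster_coreReal_mono {ω ω' : Config ι} (hω : ω ≤ ω') :
    cluster ends (coreReal ends A ζ ω) h ⊆ cluster ends (coreReal ends A ζ ω') h := by
  rw [hb.cluster_coreReal, hb.cluster_coreReal]; exact hb.redSet_mono hω

end Hull

end LocRows

end Summit.Ventures.PercRepro2
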